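import Literature.MathematicalPhysics.QuantumLattice.DWaveSource
import Literature.Barriers.HubbardSuperconductivity.PureModelStripeCompetition

/-!
# Route `WeakCouplingBCS` — glue item `WcbcsThesisGlue` (stmt-HubbardSuperconductivity-14261), structural

The rev-4 support item `WcbcsThesisGlue` of route `WeakCouplingBCS` is
`WcbcsSsbToTorusLRO → WcbcsBcsConstruction → WcbcsThesis` (crux 2 → crux 4 → target X, by item
name).  It is pure logic: the construction (crux 4) fixes a doping `δ ∈ (0, 1/2)`, a threshold
`U₀ > 0` and `C > 0`, and gives for every `U ∈ (0, U₀)` a density-matched chemical potential `μ`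
with `exp (-C/U²) ≤ dWaveOrderParameter U μ`; since `0 < exp (-C/U²)` this is
`HasDWaveOrder U μ` (`hasDWaveOrder_iff` is `Iff.rfl`); the transfer (crux 2) has its own
threshold `U₁ > 0` and turns density matching + `HasDWaveOrder U μ` into the summit's matrix
`HasDWavePairFieldLROAt U δ` for `U ∈ (0, U₁)`, `δ ∈ (0, 1/2)`.  With `U₀' := min U₀ U₁` both
apply, which is `X` at `(U₀', δ)`.

DESIGN (requested by the route text, rev 4 header "PROVERS: … do NOT `import …Theses.WeakCouplingBCS`
in a file that closes an item"): the TYPE below is spelled out STRUCTURALLY — the verbatim bodies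
of the route decls `WcbcsSsbToTorusLRO`, `WcbcsBcsConstruction`, `WcbcsThesis`
(Theses/WeakCouplingBCS.lean rev 4) — and this module imports only the two Literature modules that
own the vocabulary (`DWaveSource`: `hubbardTorusWith`, `groundStateFunctional`, `totalNumber`,
`dWaveOrderParameter`, `HasDWaveOrder`; `PureModelStripeCompetition`: `HasDWavePairFieldLROAt`),
NOT the Theses module: the gate appends `WcbcsThesisGlue_holds := _root_.<this theorem>` to the
Theses file by importing this module there, so a Theses import here would close an import cycle
(the defect that froze `WcbcsSectorBookkeeping`, rev-2 change log).  The type is definitionally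
equal to `Summit.HubbardSuperconductivity.HubbardSuperconductivity.Theses.WeakCouplingBCS.WcbcsThesisGlue`
(`δ`-unfolding of the four defs; checked against the rev-4 Theses file with
`example : WeakCouplingBCS.WcbcsThesisGlue := by exact wcbcsThesisGlue_proof` in a scratch file,
rc 0).  Same term as the route's deciding theorem `WeakCouplingBCS.closes` without the final
halving of `U`.
-/

namespace Summit.HubbardSuperconductivity.HubbardSuperconductivity.Theorems

/-- **`WcbcsThesisGlue`** (route `WeakCouplingBCS`, item `stmt-HubbardSuperconductivity-14261`),
stated structurally: (SSB ⇒ even-torus LRO transfer, crux `WcbcsSsbToTorusLRO`) →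
(constructive BCS ground state, crux `WcbcsBcsConstruction`) → (thesis `WcbcsThesis`:
`∃ U₀ > 0, ∃ δ ∈ (0,1/2), ∀ U ∈ (0,U₀), HasDWavePairFieldLROAt U δ`).  Pure logic:
`U₀ := min U₀ U₁`, `δ, C, μ` from the construction, `0 < exp (-C/U²) ≤ m(U, μ)` gives
`HasDWaveOrder U μ`, then the transfer. [folklore] -/
theorem wcbcsThesisGlue_proof :
    (∃ U₀ : ℝ, 0 < U₀ ∧ ∀ U ∈ Set.Ioo (0:ℝ) U₀, ∀ δ ∈ Set.Ioo (0:ℝ) (1 / 2), ∀ μ : ℝ, Filter.Tendsto (fun L : ℕ => ((Literature.MathematicalPhysics.QuantumLattice.hubbardTorusWith 2 (L + 1) 1 U μ).groundStateFunctional Literature.MathematicalPhysics.QuantumLattice.totalNumber).re / ((L + 1 : ℕ) : ℝ) ^ 2) Filter.atTop (nhds (1 - δ)) → Literature.MathematicalPhysics.QuantumLattice.HasDWaveOrder U μ → Literature.Barriers.HubbardSuperconductivity.HasDWavePairFieldLROAt U δ) →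
      (∃ δ ∈ Set.Ioo (0:ℝ) (1 / 2), ∃ U₀ : ℝ, 0 < U₀ ∧ ∃ C : ℝ, 0 < C ∧ ∀ U ∈ Set.Ioo (0:ℝ) U₀, ∃ μ : ℝ, Filter.Tendsto (fun L : ℕ => ((Literature.MathematicalPhysics.QuantumLattice.hubbardTorusWith 2 (L + 1) 1 U μ).groundStateFunctional Literature.MathematicalPhysics.QuantumLattice.totalNumber).re / ((L + 1 : ℕ) : ℝ) ^ 2) Filter.atTop (nhds (1 - δ)) ∧ Real.exp (-C / U ^ 2) ≤ Literature.MathematicalPhysics.QuantumLattice.dWaveOrderParameter U μ) →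
      (∃ U₀ : ℝ, 0 < U₀ ∧ ∃ δ ∈ Set.Ioo (0:ℝ) (1 / 2), ∀ U ∈ Set.Ioo (0:ℝ) U₀, Literature.Barriers.HubbardSuperconductivity.HasDWavePairFieldLROAt U δ) := by
  rintro ⟨U₁, hU₁, h2⟩ ⟨δ, hδ, U₀, hU₀, C, -, h4⟩
  refine ⟨min U₀ U₁, lt_min hU₀ hU₁, δ, hδ, fun U hU => ?_⟩
  obtain ⟨μ, hdens, hm⟩ := h4 U ⟨hU.1, lt_of_lt_of_le hU.2 (min_le_left _ _)⟩
  have hord : Literature.MathematicalPhysics.QuantumLattice.HasDWaveOrder U μ :=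
    (Literature.MathematicalPhysics.QuantumLattice.hasDWaveOrder_iff _ _).2
      (lt_of_lt_of_le (Real.exp_pos _) hm)
  exact h2 U ⟨hU.1, lt_of_lt_of_le hU.2 (min_le_right _ _)⟩ δ hδ μ hdens hord

end Summit.HubbardSuperconductivity.HubbardSuperconductivity.Theorems
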